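import Summits.QuantumFields.YangMills.Theorems.ColdStartUniversalityLatticeLangevinDossSussmannFlowSecondOrder
import Literature.Analysis.ODE.PathDrivenThirdOrder
import HarnessLib

/-!
# Route `ColdStartUniversality` (fixed-cut-off SZZ dynamics; Doss–Sussmann smoothing programme, file 11):
# THIRD-ORDER BOUNDS — `‖D³Φ‖` UNIFORM in the Brownian path, via the jet of the jet

Helper file (seat `ym-line-csu-p1`, g24).  Towards `P_t(C³) ⊂ C³` (the tree's Dynkin class is `C³` with compact support):
* `exists_bound_of_vanishing_far₃`, `jetField_bounds` — (abstract proper spaces) compactness bound on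
  `{‖p‖ ≤ 1} × E × {‖w‖ ≤ W}` for continuous functions vanishing for `‖v‖ > 2`, and the resulting bounds `B₁`, `B₂` on
  the first two derivatives of the jet field `(p,(v,w)) ↦ (G(p,v), ∂G(p,v)(0,w))` of a bump-tamed field;
* `tamed_bounds_of_vanishing` — the uniform bounds `K` (value, `D`, `D²`, Lipschitz) of a tamed field from its support
  property (as in file 7, packaged);
* `norm_fderiv_three_flow_apply_le` — (abstract Banach form) third-derivative bound of a path-driven flow from
  jet-field bounds, via `Literature.Analysis.ODE.norm_fderiv_fderiv_fderiv_pathDriven_apply_le` (jet of the jet);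
* ★ `exists_dossSussmannFlow₃` — the global flow of the tamed Doss–Sussmann equation with, in addition to the properties
  of `exists_dossSussmannFlow₂`, a THIRD-derivative bound `‖D³(x ↦ Φ x τ)(x₀)(dx,dx',δ)‖ ≤ C₃‖dx‖‖dx'‖‖δ‖` with `C₃`
  INDEPENDENT of the driving path (all constants from compactness; no explicit formulas).
ELABORATION NOTE: the compactness / jet lemmas are stated over abstract normed spaces and instantiated with explicit
`(P := …) (E := …) (G := …)` — instantiating them inside `obtain … := …` on the concrete configuration type exhausts the
heartbeat budget.
THEOREMS ONLY, no sorry.  HONEST FRAMING: fixed-cut-off plumbing; nothing K-uniform; no crux, rung or summit statement is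
proved; the Yang–Mills mass gap is NOT proved.
-/

set_option autoImplicit false

noncomputable section

namespace Summit.QuantumFields.YangMills.Theorems.ColdStartUniversality

open MeasureTheory Finset Filter Set Metric Function unitInterval
open scoped NNReal Matrix Topology
open Literature.MathematicalPhysics.QuantumFieldTheory Literature.Analysis.ODE
open Literature.MathematicalPhysics.QuantumLattice (fundamentalRep fundamentalLatticeRep continuous_fundamentalRep
  fundamentalRep_mem_unitaryGroup)

variable {L : ℕ}

/-- **Compactness bound on `{‖p‖ ≤ 1} × E × {‖w‖ ≤ W}` for a function vanishing far out in the middle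
variable** (proper spaces).  A continuous function of `(p, (v, w))` which vanishes for `‖v‖ > 2` is bounded on
`{‖p‖ ≤ 1, ‖w‖ ≤ W}`. [folklore] -/
theorem exists_bound_of_vanishing_far₃ {P E X : Type*} [NormedAddCommGroup P] [ProperSpace P]
    [NormedAddCommGroup E] [ProperSpace E] [SeminormedAddCommGroup X]
    {H : P × (E × E) → X} (hc : Continuous H) (h0 : ∀ r, 2 < ‖r.2.1‖ → H r = 0) (W : ℝ) :
    ∃ C : ℝ, 0 ≤ C ∧ ∀ r, ‖r.1‖ ≤ 1 → ‖r.2.2‖ ≤ W → ‖H r‖ ≤ C := by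
  have hS : IsCompact (closedBall (0 : P) 1 ×ˢ (closedBall (0 : E) 2 ×ˢ closedBall (0 : E) W)) :=
    (isCompact_closedBall _ _).prod ((isCompact_closedBall _ _).prod (isCompact_closedBall _ _))
  obtain ⟨C, hC⟩ := hS.exists_bound_of_continuousOn hc.continuousOn
  refine ⟨max C 0, le_max_right _ _, fun r hp hw => ?_⟩
  by_cases hv : ‖r.2.1‖ ≤ 2
  · have hmem : r ∈ closedBall (0 : P) 1 ×ˢ (closedBall (0 : E) 2 ×ˢ closedBall (0 : E) W) :=
      ⟨mem_closedBall_zero_iff.2 hp, mem_closedBall_zero_iff.2 hv, mem_closedBall_zero_iff.2 hw⟩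
    exact (hC r hmem).trans (le_max_left _ _)
  · rw [h0 r (lt_of_not_ge hv), norm_zero]; exact le_max_right _ _

/-- **Uniform bounds of a tamed field from its support property** (packaged form of the argument of file 7).
[folklore] -/
theorem tamed_bounds_of_vanishing [NeZero L]
    {G : (Edge 3 L → Fin (fundamentalLatticeRep 2).N → Fin (fundamentalLatticeRep 2).N → ℂ) ×
        (Edge 3 L → Fin (fundamentalLatticeRep 2).N → Fin (fundamentalLatticeRep 2).N → ℂ) →
        (Edge 3 L → Fin (fundamentalLatticeRep 2).N → Fin (fundamentalLatticeRep 2).N → ℂ)}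
    (hG : ContDiff ℝ (⊤ : ℕ∞) G) (hG0 : ∀ q, 2 < ‖q.2‖ → G =ᶠ[𝓝 q] fun _ => 0) :
    ∃ K : ℝ≥0,
      (∀ p M, ‖p‖ ≤ 1 → ‖G (p, M)‖ ≤ K) ∧
      (∀ p M, ‖p‖ ≤ 1 → ‖fderiv ℝ G (p, M)‖ ≤ K) ∧
      (∀ p, ‖p‖ ≤ 1 → LipschitzWith K fun M => G (p, M)) ∧
      (∀ p M, ‖p‖ ≤ 1 → ‖fderiv ℝ (fderiv ℝ G) (p, M)‖ ≤ K) := by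
  let Cfg : Type := Edge 3 L → Fin (fundamentalLatticeRep 2).N → Fin (fundamentalLatticeRep 2).N → ℂ
  have hG2 : ContDiff ℝ 2 G := contDiff_infty.1 hG 2
  have hG1 : ContDiff ℝ 1 G := contDiff_infty.1 hG 1
  have hGd : Differentiable ℝ G := hG1.differentiable one_ne_zero
  have hGc' : Continuous (fderiv ℝ G) := hG1.continuous_fderiv one_ne_zero
  have hG'1 : ContDiff ℝ 1 (fderiv ℝ G) := hG2.fderiv_right (m := 1) le_rfl
  have hGc'' : Continuous (fderiv ℝ (fderiv ℝ G)) := hG'1.continuous_fderiv one_ne_zero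
  have h0 : ∀ q : Cfg × Cfg, 2 < ‖q.2‖ → G q = 0 := fun q hq => (hG0 q hq).self_of_nhds
  have hG0' : ∀ q : Cfg × Cfg, 2 < ‖q.2‖ → fderiv ℝ G =ᶠ[𝓝 q] fun _ => 0 := fun q hq => by
    have hopen : IsOpen {q' : Cfg × Cfg | 2 < ‖q'.2‖} := isOpen_lt continuous_const (continuous_norm.comp continuous_snd)
    filter_upwards [hopen.mem_nhds hq] with q' hq'
    rw [(hG0 q' hq').fderiv_eq (𝕜 := ℝ), fderiv_const_apply]
  have h1 : ∀ q : Cfg × Cfg, 2 < ‖q.2‖ → fderiv ℝ G q = 0 := fun q hq => (hG0' q hq).self_of_nhds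
  have h2 : ∀ q : Cfg × Cfg, 2 < ‖q.2‖ → fderiv ℝ (fderiv ℝ G) q = 0 := fun q hq => by
    rw [(hG0' q hq).fderiv_eq (𝕜 := ℝ), fderiv_const_apply]
  obtain ⟨C₀, hC₀0, hC₀⟩ := exists_bound_of_vanishing_far (L := L) (H := G) hG.continuous h0
  obtain ⟨C₁, hC₁0, hC₁⟩ := exists_bound_of_vanishing_far (L := L) (H := fderiv ℝ G) hGc' h1
  obtain ⟨C₂, hC₂0, hC₂⟩ := exists_bound_of_vanishing_far (L := L) (H := fderiv ℝ (fderiv ℝ G)) hGc'' h2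
  let K : ℝ≥0 := ⟨C₀ + C₁ + C₂, by positivity⟩
  have hKc : (K : ℝ) = C₀ + C₁ + C₂ := rfl
  have hKC₀ : C₀ ≤ (K : ℝ) := by rw [hKc]; linarith
  have hKC₁ : C₁ ≤ (K : ℝ) := by rw [hKc]; linarith
  have hKC₂ : C₂ ≤ (K : ℝ) := by rw [hKc]; linarith
  have hbound1 : ∀ p M, ‖p‖ ≤ 1 → ‖fderiv ℝ G (p, M)‖ ≤ K := fun p M hp => (hC₁ p M hp).trans hKC₁
  have hlip : ∀ p, ‖p‖ ≤ 1 → LipschitzWith K fun M => G (p, M) := by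
    intro p hp
    have hd : ∀ M, HasFDerivAt (fun M => G (p, M))
        ((fderiv ℝ G (p, M)).comp (ContinuousLinearMap.inr ℝ Cfg Cfg)) M :=
      fun M => (hGd (p, M)).hasFDerivAt.comp M (hasFDerivAt_prodMk_right (𝕜 := ℝ) p M)
    refine lipschitzWith_of_nnnorm_fderiv_le (fun M => (hd M).differentiableAt) fun M => ?_
    rw [(hd M).fderiv]
    have h : ‖(fderiv ℝ G (p, M)).comp (ContinuousLinearMap.inr ℝ Cfg Cfg)‖ ≤ K :=
      (ContinuousLinearMap.opNorm_comp_le _ _).trans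
        ((mul_le_of_le_one_right (norm_nonneg _) (ContinuousLinearMap.norm_inr_le_one ℝ Cfg Cfg)).trans
          (hbound1 p M hp))
    rw [← NNReal.coe_le_coe, coe_nnnorm]
    exact h
  exact ⟨K, fun p M hp => (hC₀ p M hp).trans hKC₀, hbound1, hlip, fun p M hp => (hC₂ p M hp).trans hKC₂⟩

/-- **Derivative bounds for the jet field of a bump-tamed field** (proper spaces) on `{‖p‖ ≤ 1} × E × {‖w‖ ≤ W}`:
the jet field `(p,(v,w)) ↦ (G(p,v), ∂G(p,v)(0,w))` of a smooth field vanishing for `‖v‖ > 2` vanishes there too, so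
its first two derivatives are bounded by compactness. [folklore] -/
theorem jetField_bounds {P E : Type*} [NormedAddCommGroup P] [NormedSpace ℝ P] [ProperSpace P]
    [NormedAddCommGroup E] [NormedSpace ℝ E] [ProperSpace E]
    {G : P × E → E} (hG : ContDiff ℝ (⊤ : ℕ∞) G) (hG0 : ∀ q, 2 < ‖q.2‖ → G =ᶠ[𝓝 q] fun _ => 0) (W : ℝ) :
    ∃ B₁ B₂ : ℝ, 0 ≤ B₁ ∧ 0 ≤ B₂ ∧ ∀ r : P × (E × E), ‖r.1‖ ≤ 1 → ‖r.2.2‖ ≤ W →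
      ‖fderiv ℝ (fun r' : P × (E × E) => (G (r'.1, r'.2.1), fderiv ℝ G (r'.1, r'.2.1) ((0 : P), r'.2.2))) r‖
          ≤ B₁ ∧
      ‖fderiv ℝ (fderiv ℝ (fun r' : P × (E × E) =>
          (G (r'.1, r'.2.1), fderiv ℝ G (r'.1, r'.2.1) ((0 : P), r'.2.2)))) r‖ ≤ B₂ := by
  have hG3 : ContDiff ℝ 3 G := contDiff_infty.1 hG 3
  set JT : P × (E × E) → E × E := fun r => (G (r.1, r.2.1), fderiv ℝ G (r.1, r.2.1) ((0 : P), r.2.2)) with hJT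
  have hJTs : ContDiff ℝ 2 JT := by
    have hpr : ContDiff ℝ 2 fun r : P × (E × E) => ((r.1, r.2.1) : P × E) :=
      contDiff_fst.prodMk (contDiff_fst.comp contDiff_snd)
    have hdir : ContDiff ℝ 2 fun r : P × (E × E) => (((0 : P), r.2.2) : P × E) :=
      contDiff_const.prodMk (contDiff_snd.comp contDiff_snd)
    exact ((contDiff_infty.1 hG 2).comp hpr).prodMk
      ((hG3.contDiff_fderiv_apply (m := 2) (by norm_num)).comp (hpr.prodMk hdir))
  have hJT1 : ContDiff ℝ 1 JT := hJTs.of_le (by norm_num)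
  have hJTc' : Continuous (fderiv ℝ JT) := hJT1.continuous_fderiv one_ne_zero
  have hJT'1 : ContDiff ℝ 1 (fderiv ℝ JT) := hJTs.fderiv_right (m := 1) le_rfl
  have hJTc'' : Continuous (fderiv ℝ (fderiv ℝ JT)) := hJT'1.continuous_fderiv one_ne_zero
  have hopen : IsOpen {r' : P × (E × E) | 2 < ‖r'.2.1‖} :=
    isOpen_lt continuous_const (continuous_norm.comp (continuous_fst.comp continuous_snd))
  have hJT0 : ∀ r : P × (E × E), 2 < ‖r.2.1‖ → JT =ᶠ[𝓝 r] fun _ => 0 := by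
    intro r hr
    filter_upwards [hopen.mem_nhds hr] with r' hr'
    have h0 : G (r'.1, r'.2.1) = 0 := (hG0 (r'.1, r'.2.1) hr').self_of_nhds
    have h1 : fderiv ℝ G (r'.1, r'.2.1) = 0 := by
      rw [(hG0 (r'.1, r'.2.1) hr').fderiv_eq (𝕜 := ℝ), fderiv_const_apply]
    show (G (r'.1, r'.2.1), fderiv ℝ G (r'.1, r'.2.1) ((0 : P), r'.2.2)) = 0
    rw [h0, h1]; rfl
  have hJT0' : ∀ r : P × (E × E), 2 < ‖r.2.1‖ → fderiv ℝ JT =ᶠ[𝓝 r] fun _ => 0 := fun r hr => by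
    filter_upwards [hopen.mem_nhds hr] with r' hr'
    rw [(hJT0 r' hr').fderiv_eq (𝕜 := ℝ), fderiv_const_apply]
  have hv1 : ∀ r : P × (E × E), 2 < ‖r.2.1‖ → fderiv ℝ JT r = 0 := fun r hr => (hJT0' r hr).self_of_nhds
  have hv2 : ∀ r : P × (E × E), 2 < ‖r.2.1‖ → fderiv ℝ (fderiv ℝ JT) r = 0 := fun r hr => by
    rw [(hJT0' r hr).fderiv_eq (𝕜 := ℝ), fderiv_const_apply]
  obtain ⟨B₁, hB₁0, hB₁⟩ := exists_bound_of_vanishing_far₃ (H := fderiv ℝ JT) hJTc' hv1 W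
  obtain ⟨B₂, hB₂0, hB₂⟩ := exists_bound_of_vanishing_far₃ (H := fderiv ℝ (fderiv ℝ JT)) hJTc'' hv2 W
  exact ⟨B₁, B₂, hB₁0, hB₂0, fun r hp hw => ⟨hB₁ r hp hw, hB₂ r hp hw⟩⟩

/-- **Third-derivative bound for a path-driven flow from jet-field bounds** (abstract Banach form; the
quantitative core of `exists_dossSussmannFlow₃`).  If `‖∂GT(p,M)‖ ≤ A` for `‖p‖ ≤ 1`, the frame path stays in the unit
ball, and the first two derivatives of the jet field `(p,(v,w)) ↦ (GT(p,v), ∂GT(p,v)(0,w))` are bounded by `B₁`, `B₂`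
on `{‖p‖ ≤ 1, ‖w‖ ≤ e^{A}}`, then `‖D³(x ↦ Φ x τ)(x₀)(dx,dx',δ)‖ ≤ e^{B₁ + B₂ e^{B₁}}‖dx‖‖dx'‖‖δ‖` (jet of the jet,
`Literature.Analysis.ODE.norm_fderiv_fderiv_fderiv_pathDriven_apply_le`, plus homogeneity in `δ`). [folklore] -/
theorem norm_fderiv_three_flow_apply_le {E : Type*} [NormedAddCommGroup E] [NormedSpace ℝ E] [CompleteSpace E]
    {GT : E × E → E} (hGT : ContDiff ℝ (⊤ : ℕ∞) GT) {A B₁ B₂ : ℝ} (hA : 0 ≤ A) (hB₁0 : 0 ≤ B₁) (hB₂0 : 0 ≤ B₂)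
    (hK : ∀ p M, ‖p‖ ≤ 1 → ‖fderiv ℝ GT (p, M)‖ ≤ A)
    (hB : ∀ r : E × (E × E), ‖r.1‖ ≤ 1 → ‖r.2.2‖ ≤ Real.exp A →
      ‖fderiv ℝ (fun r' : E × (E × E) => (GT (r'.1, r'.2.1), fderiv ℝ GT (r'.1, r'.2.1) ((0 : E), r'.2.2))) r‖
          ≤ B₁ ∧
      ‖fderiv ℝ (fderiv ℝ (fun r' : E × (E × E) =>
          (GT (r'.1, r'.2.1), fderiv ℝ GT (r'.1, r'.2.1) ((0 : E), r'.2.2)))) r‖ ≤ B₂)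
    (c : C(I, E)) (hc : ∀ τ, ‖c τ‖ ≤ 1) {Φ : E → C(I, E)}
    (hΦ : ∀ x (τ : I), Φ x τ = x + ∫ s in (0:ℝ)..(τ:ℝ),
      GT (IccExtend zero_le_one c s, IccExtend zero_le_one (Φ x) s))
    (huniq : ∀ x (α : C(I, E)), (∀ τ : I, α τ = x + ∫ s in (0:ℝ)..(τ:ℝ),
      GT (IccExtend zero_le_one c s, IccExtend zero_le_one α s)) → α = Φ x)
    (x₀ : E) (τ : I) (dx dx' δ : E) :
    ‖fderiv ℝ (fderiv ℝ (fderiv ℝ (fun x => Φ x τ))) x₀ dx dx' δ‖ ≤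
      Real.exp (B₁ + B₂ * Real.exp B₁) * ‖dx‖ * ‖dx'‖ * ‖δ‖ := by
  have hGT3 : ContDiff ℝ 3 GT := contDiff_infty.1 hGT 3
  -- first-order bound along the jet: `‖DΦ(x₀) δ₀ (s)‖ ≤ e^{A}` for `‖δ₀‖ ≤ 1`
  have hb : ∀ (s : I) (u : E), ‖fderiv ℝ GT (c s, Φ x₀ s) ((0 : E), u)‖ ≤ A * ‖u‖ := fun s u => by
    have h0 : ‖((0 : E), u)‖ ≤ ‖u‖ := by simp [Prod.norm_def]
    calc ‖fderiv ℝ GT (c s, Φ x₀ s) ((0 : E), u)‖ ≤ ‖fderiv ℝ GT (c s, Φ x₀ s)‖ * ‖((0 : E), u)‖ :=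
          ContinuousLinearMap.le_opNorm _ _
      _ ≤ A * ‖u‖ := mul_le_mul (hK _ _ (hc s)) h0 (norm_nonneg _) hA
  have hw : ∀ (δ₀ : E), ‖δ₀‖ ≤ 1 → ∀ s : I, ‖fderiv ℝ Φ x₀ δ₀ s‖ ≤ Real.exp A := by
    intro δ₀ hδ₀ s
    refine (norm_fderiv_pathDriven_solution_family_apply_le (hGT.of_le (by exact_mod_cast le_top)) le_rfl c hΦ
      huniq x₀ hA hb δ₀ s).trans ?_
    calc ‖δ₀‖ * Real.exp (A * s) ≤ 1 * Real.exp (A * 1) := by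
          gcongr
          · exact s.2.2
      _ = Real.exp A := by rw [one_mul, mul_one]
  -- the third-derivative bound on directions `δ₀` of norm at most one
  have hunit : ∀ (δ₀ : E), ‖δ₀‖ ≤ 1 → ∀ dx dx' : E,
      ‖fderiv ℝ (fderiv ℝ (fderiv ℝ (fun x => Φ x τ))) x₀ dx dx' δ₀‖ ≤
        Real.exp ((B₁ + B₂ * Real.exp B₁) * τ) * ‖dx‖ * ‖dx'‖ := by
    intro δ₀ hδ₀ dx dx'
    have hG3 : ContDiff ℝ ((1 + 1 + 1 : ℕ∞) : WithTop ℕ∞) GT := hGT3.of_le (by norm_num)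
    refine norm_fderiv_fderiv_fderiv_pathDriven_apply_le (n := 1) hG3 le_rfl c hΦ huniq x₀ δ₀ hB₁0 hB₂0
      (fun s u => ?_) (fun s u u' => ?_) τ dx dx'
    · have hpt := (hB (c s, (((Φ x₀).prodMk (fderiv ℝ Φ x₀ δ₀)) s)) (hc s) (hw δ₀ hδ₀ s)).1
      refine (ContinuousLinearMap.le_opNorm _ _).trans ?_
      have h0 : ‖((0 : E), u)‖ ≤ ‖u‖ := by simp [Prod.norm_def]
      exact mul_le_mul hpt h0 (norm_nonneg _) hB₁0
    · have hpt := (hB (c s, (((Φ x₀).prodMk (fderiv ℝ Φ x₀ δ₀)) s)) (hc s) (hw δ₀ hδ₀ s)).2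
      have h0 : ‖((0 : E), u)‖ ≤ ‖u‖ := by simp [Prod.norm_def]
      have h0' : ‖((0 : E), u')‖ ≤ ‖u'‖ := by simp [Prod.norm_def]
      calc _ ≤ ‖fderiv ℝ (fderiv ℝ (fun r : E × (E × E) =>
              (GT (r.1, r.2.1), fderiv ℝ GT (r.1, r.2.1) ((0 : E), r.2.2))))
              (c s, ((Φ x₀).prodMk (fderiv ℝ Φ x₀ δ₀)) s) ((0 : E), u)‖ * ‖((0 : E), u')‖ :=
            ContinuousLinearMap.le_opNorm _ _
        _ ≤ (B₂ * ‖((0 : E), u)‖) * ‖((0 : E), u')‖ :=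
            mul_le_mul_of_nonneg_right (ContinuousLinearMap.le_of_opNorm_le _ hpt _) (norm_nonneg _)
        _ ≤ B₂ * ‖u‖ * ‖u'‖ := by gcongr
  -- all directions, by homogeneity in `δ`
  have hexp : Real.exp ((B₁ + B₂ * Real.exp B₁) * τ) ≤ Real.exp (B₁ + B₂ * Real.exp B₁) := by
    apply Real.exp_le_exp.2
    have hB : 0 ≤ B₁ + B₂ * Real.exp B₁ := by positivity
    calc (B₁ + B₂ * Real.exp B₁) * (τ : ℝ) ≤ (B₁ + B₂ * Real.exp B₁) * 1 := by gcongr; exact τ.2.2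
      _ = _ := mul_one _
  by_cases hδ : δ = 0
  · subst hδ; simp
  · have hδn : ‖δ‖ ≠ 0 := norm_ne_zero_iff.2 hδ
    set δ₀ : E := ‖δ‖⁻¹ • δ with hδ₀
    have hδ₀n : ‖δ₀‖ = 1 := by rw [hδ₀, norm_smul, norm_inv, norm_norm, inv_mul_cancel₀ hδn]
    have hδeq : δ = ‖δ‖ • δ₀ := by rw [hδ₀, smul_smul, mul_inv_cancel₀ hδn, one_smul]
    have hval : fderiv ℝ (fderiv ℝ (fderiv ℝ (fun x => Φ x τ))) x₀ dx dx' δ =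
        ‖δ‖ • fderiv ℝ (fderiv ℝ (fderiv ℝ (fun x => Φ x τ))) x₀ dx dx' δ₀ := by
      conv_lhs => rw [hδeq]
      rw [map_smul]
    rw [hval, norm_smul, norm_norm]
    have h := hunit δ₀ hδ₀n.le dx dx'
    calc ‖δ‖ * ‖fderiv ℝ (fderiv ℝ (fderiv ℝ (fun x => Φ x τ))) x₀ dx dx' δ₀‖
        ≤ ‖δ‖ * (Real.exp (B₁ + B₂ * Real.exp B₁) * ‖dx‖ * ‖dx'‖) :=
          mul_le_mul_of_nonneg_left (h.trans (by gcongr)) (norm_nonneg _)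
      _ = Real.exp (B₁ + B₂ * Real.exp B₁) * ‖dx‖ * ‖dx'‖ * ‖δ‖ := by ring

/-- ★ **The Doss–Sussmann flow with third-derivative bound.**  For the bump-tamed field `G` (smooth, vanishing for
`‖M‖ > 2`; `exists_tamed_dossSussmannField_vanishing`) and `T ≥ 0` there are constants `K`, `C₃` such that for EVERY
continuous frame path `c` with `‖c(τ)‖ ≤ 1` the flow of `exists_dossSussmannFlow₂` satisfies in addition
`‖D³(x ↦ Φ x τ)(x₀)(dx,dx',δ)‖ ≤ C₃‖dx‖‖dx'‖‖δ‖` — `C₃` INDEPENDENT of the path (jet of the jet; the derivative bounds of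
the jet field come from compactness). [folklore] -/
theorem exists_dossSussmannFlow₃ [NeZero L]
    {G : (Edge 3 L → Fin (fundamentalLatticeRep 2).N → Fin (fundamentalLatticeRep 2).N → ℂ) ×
        (Edge 3 L → Fin (fundamentalLatticeRep 2).N → Fin (fundamentalLatticeRep 2).N → ℂ) →
        (Edge 3 L → Fin (fundamentalLatticeRep 2).N → Fin (fundamentalLatticeRep 2).N → ℂ)}
    (hG : ContDiff ℝ (⊤ : ℕ∞) G) (hG0 : ∀ q, 2 < ‖q.2‖ → G =ᶠ[𝓝 q] fun _ => 0) {T : ℝ} (hT : 0 ≤ T) :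
    ∃ (K : ℝ≥0) (C₃ : ℝ),
      (∀ p M, ‖p‖ ≤ 1 → ‖G (p, M)‖ ≤ K) ∧ (∀ p M, ‖p‖ ≤ 1 → ‖fderiv ℝ G (p, M)‖ ≤ K) ∧
      (∀ p, ‖p‖ ≤ 1 → LipschitzWith K fun M => G (p, M)) ∧
      (∀ p M, ‖p‖ ≤ 1 → ‖fderiv ℝ (fderiv ℝ G) (p, M)‖ ≤ K) ∧
      ∀ (c : C(I, Edge 3 L → Fin (fundamentalLatticeRep 2).N → Fin (fundamentalLatticeRep 2).N → ℂ)),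
        (∀ τ, ‖c τ‖ ≤ 1) →
        ∃ Φ : (Edge 3 L → Fin (fundamentalLatticeRep 2).N → Fin (fundamentalLatticeRep 2).N → ℂ) →
            C(I, Edge 3 L → Fin (fundamentalLatticeRep 2).N → Fin (fundamentalLatticeRep 2).N → ℂ),
          (∀ x (τ : I), Φ x τ = x + ∫ s in (0:ℝ)..(τ:ℝ),
            T • G (IccExtend zero_le_one c s, IccExtend zero_le_one (Φ x) s)) ∧
          (∀ x (α : C(I, Edge 3 L → Fin (fundamentalLatticeRep 2).N → Fin (fundamentalLatticeRep 2).N → ℂ)),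
            (∀ τ : I, α τ = x + ∫ s in (0:ℝ)..(τ:ℝ),
              T • G (IccExtend zero_le_one c s, IccExtend zero_le_one α s)) → α = Φ x) ∧
          ContDiff ℝ (⊤ : ℕ∞) Φ ∧
          (∀ x₀ (τ : I), ‖fderiv ℝ (fun x => Φ x τ) x₀‖ ≤ Real.exp (T * K * τ)) ∧
          (∀ x (τ : I), ‖Φ x τ - x‖ ≤ T * K * τ) ∧
          (∀ x₀ (τ : I), ‖fderiv ℝ (fderiv ℝ (fun x => Φ x τ)) x₀‖ ≤
            Real.exp ((T * K + T * K * Real.exp (T * K)) * τ)) ∧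
          (∀ x₀ (τ : I) (dx dx' δ : Edge 3 L → Fin (fundamentalLatticeRep 2).N → Fin (fundamentalLatticeRep 2).N → ℂ),
            ‖fderiv ℝ (fderiv ℝ (fderiv ℝ (fun x => Φ x τ))) x₀ dx dx' δ‖ ≤ C₃ * ‖dx‖ * ‖dx'‖ * ‖δ‖) := by
  let Cfg : Type := Edge 3 L → Fin (fundamentalLatticeRep 2).N → Fin (fundamentalLatticeRep 2).N → ℂ
  obtain ⟨K, hK0, hK1, hK2, hK3⟩ := tamed_bounds_of_vanishing (L := L) hG hG0
  -- the scaled field `T • G`: smooth, vanishing for `‖M‖ > 2`; its derivative bound `K'` and jet-field bounds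
  have hGTs : ContDiff ℝ (⊤ : ℕ∞) (fun q : Cfg × Cfg => T • G q) := hG.const_smul T
  have hGT0 : ∀ q : Cfg × Cfg, 2 < ‖q.2‖ → (fun q : Cfg × Cfg => T • G q) =ᶠ[𝓝 q] fun _ => 0 := fun q hq => by
    filter_upwards [hG0 q hq] with q' hq'
    rw [hq', smul_zero]
  have hKB := tamed_bounds_of_vanishing (L := L) (G := fun q : Cfg × Cfg => T • G q) hGTs hGT0
  obtain ⟨K', -, hK'1, -, -⟩ := hKB
  have hJB := jetField_bounds (P := Cfg) (E := Cfg) (G := fun q : Cfg × Cfg => T • G q) hGTs hGT0 (Real.exp K')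
  obtain ⟨B₁, B₂, hB₁0, hB₂0, hB⟩ := hJB
  refine ⟨K, Real.exp (B₁ + B₂ * Real.exp B₁), hK0, hK1, hK2, hK3, fun c hc => ?_⟩
  have hF := exists_dossSussmannFlow₂ (L := L) (G := G) hG hK0 hK1 hK2 hK3 hT c hc
  obtain ⟨Φ, hΦ, huniq, hs, hd1, hdisp, hd2⟩ := hF
  exact ⟨Φ, hΦ, huniq, hs, hd1, hdisp, hd2, fun x₀ τ dx dx' δ =>
    norm_fderiv_three_flow_apply_le (GT := fun q : Cfg × Cfg => T • G q) hGTs K'.coe_nonneg hB₁0 hB₂0 hK'1 hB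
      c hc hΦ huniq x₀ τ dx dx' δ⟩

end Summit.QuantumFields.YangMills.Theorems.ColdStartUniversality

end
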